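import Summits.BirchSwinnertonDyer.BirchSwinnertonDyer.Theorems.ErratumRoadFiveAuxPrimeOfFrobeniusWitness
import Summits.BirchSwinnertonDyer.BirchSwinnertonDyer.Theorems.ClassRecordThreeCornerAtThreeFrobeniusKummerCongruence
import Summits.BirchSwinnertonDyer.BirchSwinnertonDyer.Theorems.ClassRecordThreeCornerAtThreeKummerExclusionCubic
import Summits.BirchSwinnertonDyer.BirchSwinnertonDyer.Theorems.ClassRecordThreeCornerAtThreeSplitAuxPrimePlumbing
import Literature.NumberTheory.EllipticCurves.SerreOpenImageDeterminantProofs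
import Literature.NumberTheory.GaloisRepresentations.ImaginaryQuadraticCyclotomicProofs
import HarnessLib

/-!
# The SPLIT auxiliary prime of (c′) from ONE witness — Chebotarev step (C) of the split prime-conductor Chebotarev–Kummer supply
# (cell `bsd-stepL`, seat `bsd-stepL-corner3-p2` g15 = lane B, LINE OWNER of crux 21420 `CornerAtThreeW`; `--supports stmt-BirchSwinnertonDyer-21420 --as helper`)

WHY. Conjunct (c′) of the r18/r19 residual stub `stub_upper3_residualMulti` of `Cruxes/CornerAtThreeW/Lines/inert.lean` asks, for a
corner frame `(E, K, q, m₀, E)`, for an odd prime `ℓ₀ ∤ N m₀` SPLIT in `K`, splitting completely in `K[m₀]`, with `3 ∤ a_{ℓ₀} − 2`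
and `3^E ∣ ord [𝔮]_{ℓ₀}`. THIS FILE is the CHEBOTAREV STEP (the split twin of er5 -w2's `AuxPrimeSupply.exists_auxPrime_of_frobeniusWitness`):
`exists_splitAuxPrime_of_witness` — given `E = W/ℚ` globally minimal, `K` imaginary quadratic with a `ℚ`-embedding `e : K → ℚ̄` and a
`ℚ`-automorphism `τ` of `K`, a finite Galois `R/K` (the ring class field), `E ≥ 1`, `ζ ∈ ℚ̄` primitive of order `3^E`, `β ∈ 𝓞_K`,
`α ∈ ℚ̄` with `α³ = e(β (τβ)²)`, and ONE `γ ∈ Γ_ℚ` with (W1) `γ ∈ res(res(Γ_R))`, (W2) `γ ζ = ζ`, (W3) `γ = −1` on `E[3]`,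
(W4) `γ α ≠ α` — then for every finite `T` there is a prime `ℓ ∉ T` with: `ℓ` SPLIT in `K`; `3^E ∣ ℓ − 1`; `3 ∤ a_ℓ(W) − 2`; a place
`w ∋ ℓ` of `K` splitting completely in `R` (granted `w` unramified in `R`); and `∀ a ∈ ℤ, β^{(ℓ−1)/3} ≢ a (mod ℓ𝓞_K)`.
PROOF (pattern of the tree's F2 / `exists_kolyvaginPrime_gt`). (W1)–(W4) cut out an OPEN subset of `Γ_ℚ` (`res(res Γ_R)` is closed of
finite index; stabilisers and `ker ρ̄_{E,3}` are open), non-empty by hypothesis; Chebotarev (`absoluteGaloisGroup.frobenius_dense`, PROVED in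
the tree) puts an arithmetic Frobenius `γ₁` at `𝔓₀ ∣ ℓ` in it, `ℓ ∉ T ∪ {2,3} ∪ primes(Δ N(x))`, `ℓ` unramified in `K`. Then:
(i) `γ₁ ∈ Γ_K` ⟹ both places of `K` over `ℓ` have `f = 1` (`exists_places_split_of_mem_range`) ⟹ `#{𝔭 ∣ ℓ} = 2` (trichotomy in a
quadratic field); (ii) `ζ^ℓ ≡ γ₁ζ = ζ` ⟹ `3^E ∣ ℓ − 1`; (iii) in the tree's frame of `E[3]`, `Φ(ρ̄ γ₁) = −1` has trace `−2 = a_ℓ (mod 3)`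
(`trace_galoisRepTorsion_frobenius_eq`) ⟹ `3 ∤ a_ℓ − 2`; (iv) the Frobenius `τ₀ ∈ Γ_K` at `𝔔₀ ∣ w` over `𝔓₀` lies in `res(Γ_R)`, so
`f(w_R | w) = 1` for the place of `R` under `ι 𝔔₀` (`inertiaDeg_eq_one_of_isArithFrobAt_absGaloisRestrict`) and `w` splits completely in
the Galois `R/K`; (v) `γ₁ α = ω α` with `ω² + ω + 1 = 0` ⟹ `x^{(ℓ−1)/3} ≢ 1 (mod 𝔓₀)` (lane B g14 (D4) `pow_sub_one_not_mem_of_frob_smul_eq_mul`),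
`(β (τβ)²)` ⟹ `β^k ≢ (τβ)^k (mod 𝔓₀)` ((D5) `pow_sub_pow_not_mem_of_frob_fixed`) ⟹ `β^k` is not congruent to a rational integer mod `ℓ𝓞_K`.
HONEST FRAMING: THEOREMS ONLY (no definition, no named fact, no `sorry`); nothing about any CM point or any crux object; no stub ∕ item
closes; 21420 OPEN; no census label moves (T7); BSD is proved for no curve.
References (locators only): [cite: GrossLMS1991, §3 (p. 239)] [cite: Serre1981, §8.1 (238)] [cite: Cox2013, Thm. 8.12, §9.A]
[cite: NeukirchANT1999, Ch. I §9 (9.3)–(9.5)].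
presearch: in-tree (F2 `ErratumRoadFiveAuxPrimeOfFrobeniusWitness`, `FrobeniusPlaces`, `FrobeniusDensityTheorem`, D4/D5; §1 plumbing in the sibling
`…SplitAuxPrimePlumbing`). Axioms:
`propext`, `Classical.choice`, `Quot.sound`.
-/

set_option autoImplicit false
set_option linter.dupNamespace false -- `Summit.BirchSwinnertonDyer.BirchSwinnertonDyer` (summit = problem), tree-wide

noncomputable section

open scoped Classical Pointwise NumberField
open WeierstrassCurve NumberField IsDedekindDomain Field Rat.HeightOneSpectrum
open Literature.NumberTheory.GaloisRepresentations Literature.NumberTheory.EllipticCurves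

namespace Summit.BirchSwinnertonDyer.BirchSwinnertonDyer.Theorems.ChebKummerThree

open AuxPrimeSupply FrobeniusDictionary

/-! ### The Chebotarev step -/

/-- `(−2) − 2 ≠ 0` in `𝔽₃`. [folklore] -/
private theorem zmod3_neg_two_sub_two_ne : ¬ ((-2 : ZMod 3) - 2 = 0) := by decide

/-- **The split auxiliary prime from one witness** (the Chebotarev step of (c′); see the module docstring for the statement in words
and the proof). [cite: GrossLMS1991, §3 (p. 239)] [cite: Serre1981, §8.1 (238)] [cite: Cox2013, Thm. 8.12, §9.A]
[cite: NeukirchANT1999, Ch. I §9 (9.3)–(9.5)] -/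
theorem exists_splitAuxPrime_of_witness (W : WeierstrassCurve ℚ) [W.IsElliptic] [W.IsGloballyMinimal]
    {K : Type} [Field K] [NumberField K] (hK : IsImaginaryQuadratic K) (τ : K ≃ₐ[ℚ] K)
    (e : K →ₐ[ℚ] AlgebraicClosure ℚ)
    (R : Type) [Field R] [NumberField R] [Algebra K R] [FiniteDimensional K R] [IsGalois K R]
    {E : ℕ} (hE : 1 ≤ E) {β : 𝓞 K} {ζ α : AlgebraicClosure ℚ} (hζ : IsPrimitiveRoot ζ (3 ^ E))
    (hα : α ^ 3 = e (((β * (τ • β) ^ 2 : 𝓞 K)) : K))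
    {γ : absoluteGaloisGroup ℚ}
    (h1 : γ ∈ ((absGaloisRestrict K R).range).map (absGaloisRestrict ℚ K).toMonoidHom)
    (h2 : γ • ζ = ζ) (h3 : ∀ P : geomTorsion W (3 : ℕ), γ • P = -P) (h4 : γ • α ≠ α) (T : Finset ℕ) :
    ∃ ℓ : ℕ, ℓ.Prime ∧ ℓ ∉ T ∧ ((Ideal.span {(ℓ : ℤ)}).primesOver (𝓞 K)).ncard = 2 ∧ 3 ^ E ∣ ℓ - 1 ∧
      ¬ (3 : ℤ) ∣ W.frobeniusTrace ℓ - 2 ∧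
      (∃ w : HeightOneSpectrum (𝓞 K), (ℓ : 𝓞 K) ∈ w.asIdeal ∧
        (Algebra.IsUnramifiedIn (𝓞 R) w.asIdeal → w ∈ splitPrimes K R)) ∧
      ∀ a : ℤ, β ^ ((ℓ - 1) / 3) - (a : 𝓞 K) ∉ Ideal.span {(ℓ : 𝓞 K)} := by
  letI : Module (ZMod 3) (geomTorsion W (3 : ℕ)) := AddSubgroup.torsionBy.zmodModule
  haveI : Fact (Nat.Prime 3) := ⟨Nat.prime_three⟩
  haveI : Algebra.IsQuadraticExtension ℚ K := ⟨hK.1⟩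
  haveI : IsGalois ℚ K := inferInstance
  haveI : Algebra.IsAlgebraic ℚ K := Algebra.IsAlgebraic.of_finite ℚ K
  haveI : Algebra.IsAlgebraic K R := Algebra.IsAlgebraic.of_finite K R
  haveI : NeZero (3 ^ E) := ⟨pow_ne_zero E three_ne_zero⟩
  set H := (absGaloisRestrict ℚ K).range with hHdef
  set HR := ((absGaloisRestrict K R).range).map (absGaloisRestrict ℚ K).toMonoidHom with hHRdef
  have hHRH : HR ≤ H := by
    rintro g ⟨δ, -, rfl⟩; exact ⟨δ, rfl⟩
  have hHi : H.index = Module.finrank ℚ K := index_range_absGaloisRestrict_eq_finrank ℚ K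
  haveI hHn : H.Normal := Subgroup.normal_of_index_eq_two (hHi.trans hK.1)
  set ρ := galoisRepTorsion W (3 : ℕ) with hρ
  set x : 𝓞 K := β * (τ • β) ^ 2 with hxdef
  -- `x ≠ 0` (else `α = 0` and (W4) fails) and the norm `n₀ = N(x𝓞_K) ∈ (x)`
  have hx0 : x ≠ 0 := by
    intro h0
    have hα0 : α = 0 := pow_eq_zero_iff three_ne_zero |>.mp (by rw [hα, h0]; simp)
    exact h4 (by rw [hα0, smul_zero])
  have hα0 : α ≠ 0 := by
    intro h
    have : (e (x : K)) = 0 := by rw [← hα, h, zero_pow three_ne_zero]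
    rw [map_eq_zero_iff e e.injective, RingOfIntegers.coe_eq_zero_iff] at this
    exact hx0 this
  set n₀ : ℕ := Ideal.absNorm (Ideal.span {x}) with hn₀
  have hn₀0 : n₀ ≠ 0 := by
    rw [hn₀, Ne, Ideal.absNorm_eq_zero_iff, Ideal.span_singleton_eq_bot]; exact hx0
  obtain ⟨yx, hyx⟩ : ∃ y : 𝓞 K, y * x = (n₀ : 𝓞 K) :=
    Ideal.mem_span_singleton'.mp (Ideal.absNorm_mem (Ideal.span {x}))
  -- ### the finite exceptional set of places of `ℚ`
  set B : Finset ℕ := T ∪ {2, 3} ∪ (minimalDiscriminantInt W).natAbs.primeFactors ∪ n₀.primeFactors with hB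
  set S₁ : Set (HeightOneSpectrum (𝓞 ℚ)) := {v | ∃ q ∈ B, q.Prime ∧ (q : 𝓞 ℚ) ∈ v.asIdeal} with hS₁
  set S₂ : Set (HeightOneSpectrum (𝓞 ℚ)) := {v | ¬ Algebra.IsUnramifiedIn (𝓞 K) v.asIdeal} with hS₂
  have hS₁fin : S₁.Finite := by
    have : S₁ ⊆ ⋃ q ∈ (B.filter Nat.Prime), {v | (q : 𝓞 ℚ) ∈ v.asIdeal} := by
      intro v ⟨q, hqB, hq, hqv⟩
      simp only [Set.mem_iUnion, Finset.mem_filter]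
      exact ⟨q, ⟨hqB, hq⟩, hqv⟩
    refine Set.Finite.subset (Set.Finite.biUnion (Finset.finite_toSet _) fun q hq ↦ ?_) this
    rw [Finset.coe_filter, Set.mem_setOf_eq] at hq
    have hsub : {v : HeightOneSpectrum (𝓞 ℚ) | (q : 𝓞 ℚ) ∈ v.asIdeal}.Subsingleton :=
      fun v hv v' hv' ↦ HeightOneSpectrum.eq_of_natCast_mem_rat hq.2 hv hv'
    exact hsub.finite
  have hS₂fin : S₂.Finite := finite_setOf_not_isUnramifiedIn ℚ K
  set S := S₁ ∪ S₂ with hSdef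
  have hSfin : S.Finite := hS₁fin.union hS₂fin
  -- ### the open set of `Γ_ℚ` cut out by (W1)–(W4)
  set O : Set (absoluteGaloisGroup ℚ) :=
    {γ' | γ' ∈ HR ∧ γ' • ζ = ζ ∧ ρ γ' = ρ γ ∧ γ' • α ≠ α} with hO
  have hO₁ : IsOpen {γ' : absoluteGaloisGroup ℚ | γ' ∈ HR} := isOpen_map_range_absGaloisRestrict K hK.1 R
  have hO₂ : IsOpen {γ' : absoluteGaloisGroup ℚ | γ' • ζ = ζ} :=
    isOpen_setOf_smul_mem_of_isOpen_stabilizer ζ (LocalWeilDatum.isOpen_stabilizer ℚ ζ) {ζ}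
  have hO₃ : IsOpen {γ' : absoluteGaloisGroup ℚ | ρ γ' = ρ γ} :=
    isOpen_preimage_of_isOpen_ker ρ (W.isOpen_ker_galoisRepTorsion_holds (n := ((3 : ℕ) : ℤ)) (by norm_num)) {ρ γ}
  have hO₄ : IsOpen {γ' : absoluteGaloisGroup ℚ | γ' • α ≠ α} :=
    isOpen_setOf_smul_mem_of_isOpen_stabilizer α (LocalWeilDatum.isOpen_stabilizer ℚ α) {α}ᶜ
  have hOopen : IsOpen O := by
    have := ((hO₁.inter hO₂).inter hO₃).inter hO₄
    convert this using 1
    ext γ'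
    simp only [hO, Set.mem_setOf_eq, Set.mem_inter_iff, and_assoc]
  have hOne : O.Nonempty := ⟨γ, h1, h2, rfl, h4⟩
  -- ### Chebotarev: an arithmetic Frobenius `γ₁ ∈ O` at `𝔓₀ ∣ v`, `v ∉ S`
  obtain ⟨γ₁, ⟨hγ₁HR, hγ₁ζ, hγ₁ρ, hγ₁α⟩, v, hvS, 𝔓₀, h𝔓₀, hγ₁⟩ :=
    (absoluteGaloisGroup.frobenius_dense Literature.NumberTheory.Automorphic.chebotarev_artinRep_of_galoisSide
      ℚ S hSfin).inter_open_nonempty O hOopen hOne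
  haveI h𝔓₀prime : 𝔓₀.IsPrime := h𝔓₀.1
  have hγ₁H : γ₁ ∈ H := hHRH hγ₁HR
  -- ### the rational prime `ℓ` under `v`
  obtain ⟨ℓ, hℓ, hℓv⟩ := exists_prime_natCast_mem v
  haveI : Fact ℓ.Prime := ⟨hℓ⟩
  have hℓB : ℓ ∉ B := fun h ↦ hvS (Or.inl ⟨ℓ, h, hℓ, hℓv⟩)
  simp only [hB, Finset.mem_union, Finset.mem_insert, Finset.mem_singleton, Nat.mem_primeFactors, not_or] at hℓB
  obtain ⟨⟨⟨hℓT, hℓ2, hℓ3⟩, hℓΔ⟩, hℓn₀⟩ := hℓB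
  have hℓΔ' : ¬ (ℓ : ℤ) ∣ minimalDiscriminantInt W := fun h ↦
    hℓΔ ⟨hℓ, Int.natCast_dvd.mp h, Int.natAbs_ne_zero.mpr (minimalDiscriminantInt_ne_zero W)⟩
  have hℓn₀' : ¬ ℓ ∣ n₀ := fun h ↦ hℓn₀ ⟨hℓ, h, hn₀0⟩
  have hunr : Algebra.IsUnramifiedIn (𝓞 K) v.asIdeal := by
    by_contra h; exact hvS (Or.inr h)
  have hv : (primesEquiv v : ℕ) = ℓ := by
    have h1 : natGenerator v ∣ ℓ := by
      rw [natGenerator_dvd_iff, ← map_natCast (Rat.IsIntegralClosure.intEquiv (𝓞 ℚ)) ℓ, Ideal.apply_mem_of_equiv_iff]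
      exact hℓv
    exact (Nat.prime_dvd_prime_iff_eq (prime_natGenerator v) hℓ).mp h1
  have hℓ𝔓 : ((ℓ : ℕ) : absIntegers (𝓞 ℚ) ℚ) ∈ 𝔓₀ := natCast_mem_of_mem_primesAbove hℓv h𝔓₀
  have hnot : ∀ n : ℕ, ¬ ℓ ∣ n → ((n : ℕ) : absIntegers (𝓞 ℚ) ℚ) ∉ 𝔓₀ := fun n hn hmem ↦
    hn (dvd_of_natCast_mem_of_mem_primesAbove hℓ hℓv h𝔓₀ hmem)
  have h3E𝔓 : ((3 ^ E : ℕ) : absIntegers (𝓞 ℚ) ℚ) ∉ 𝔓₀ :=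
    hnot (3 ^ E) (fun h ↦ hℓ3 ((Nat.prime_dvd_prime_iff_eq hℓ Nat.prime_three).mp (hℓ.dvd_of_dvd_pow h)))
  -- ### (i) `ℓ` splits in `K`: both places above `v` have `f = 1`
  obtain ⟨c₀, hc₀⟩ := exists_isComplexConjugation (Rat.castHom ℝ)
  have hc₀H : c₀ ∉ H :=
    Literature.NumberTheory.GaloisRepresentations.Rat.not_mem_range_absGaloisRestrict_of_isComplexConjugation K hK.2 hc₀
  obtain ⟨P, 𝔔, τ', hdata, hf1, -, -⟩ :=
    exists_places_split_of_mem_range (F := ℚ) (M := K) (hK.1 ▸ Nat.prime_two) hHn hHi hc₀H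
      hunr h𝔓₀ hγ₁ hγ₁H
  have hsplit : ((Ideal.span {(ℓ : ℤ)}).primesOver (𝓞 K)).ncard = 2 :=
    ncard_primesOver_eq_two_of_forall_inertiaDeg_eq_one hK.1 hv hunr hf1
  -- ### (ii) `3^E ∣ ℓ - 1`
  have hq : Nat.card (𝓞 ℚ ⧸ 𝔓₀.under (𝓞 ℚ)) = ℓ := natCard_quotient_under_eq_of_mem_primesAbove hv h𝔓₀
  have h3E : 3 ^ E ∣ ℓ - 1 := by
    have hζint : IsIntegral (𝓞 ℚ) ζ := (hζ.isIntegral (pow_pos (by norm_num) E)).tower_top (A := 𝓞 ℚ)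
    set ζ' : absIntegers (𝓞 ℚ) ℚ := ⟨ζ, hζint⟩ with hζ'
    have hζ'pow : ζ' ^ (3 ^ E) = 1 := Subtype.ext (by rw [SubmonoidClass.coe_pow]; exact hζ.pow_eq_one)
    have h := hγ₁.apply_of_pow_eq_one hζ'pow h3E𝔓
    rw [hq] at h
    have h' := congrArg (fun z : absIntegers (𝓞 ℚ) ℚ ↦ (z : AlgebraicClosure ℚ)) h
    simp only [MulSemiringAction.toAlgHom_apply, integralClosure.coe_smul, SubmonoidClass.coe_pow] at h'
    -- `h' : γ₁ • ζ = ζ ^ ℓ`, and `γ₁ • ζ = ζ`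
    have hζ0 : ζ ≠ 0 := hζ.ne_zero (pow_ne_zero E three_ne_zero)
    have hone : ζ ^ (ℓ - 1) = 1 := by
      have hl : ζ ^ ℓ = ζ ^ (ℓ - 1) * ζ := by rw [← pow_succ, Nat.sub_add_cancel hℓ.one_le]
      have : ζ ^ (ℓ - 1) * ζ = 1 * ζ := by rw [← hl, ← h', hγ₁ζ, one_mul]
      exact mul_right_cancel₀ hζ0 this
    exact (hζ.pow_eq_one_iff_dvd (ℓ - 1)).mp hone
  have h3dvd : 3 ∣ ℓ - 1 := (dvd_pow_self 3 (by omega : E ≠ 0)).trans h3E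
  obtain ⟨k, hk3⟩ := h3dvd
  have hkdiv : (ℓ - 1) / 3 = k := by rw [hk3, Nat.mul_div_cancel_left _ (by norm_num : 0 < 3)]
  have hk : ℓ = 3 * k + 1 := by have := hℓ.one_le; omega
  -- ### (iii) `3 ∤ a_ℓ - 2`: `ρ̄(γ₁) = -1` has trace `-2`
  have hgood : W.HasGoodReductionAtPrime ℓ := hasGoodReductionAtPrime_of_not_dvd W ℓ hℓΔ'
  have haℓ : ¬ (3 : ℤ) ∣ W.frobeniusTrace ℓ - 2 := by
    obtain ⟨ef, Φ, hef, htrf, -⟩ := exists_frame_galoisRepTorsion_rat W 3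
    have hℓ3' : ℓ ≠ 3 := hℓ3
    have htr := W.trace_galoisRepTorsion_frobenius_eq 3 (p := ℓ) hℓ3' hgood hv h𝔓₀ hγ₁
    -- `Φ (ρ γ₁) = -1`
    have hneg : ∀ Q : geomTorsion W (3 : ℕ), γ₁ • Q = -Q := by
      intro Q
      have : (ρ γ₁).toAdd Q = (ρ γ).toAdd Q := by rw [hγ₁ρ]
      rw [hρ, galoisRepTorsion_apply, galoisRepTorsion_apply] at this
      rw [this, h3]
    have hmat : ((Φ (ρ γ₁) : GL (Fin 2) (ZMod 3)) : Matrix (Fin 2) (Fin 2) (ZMod 3)) = -1 := by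
      apply Matrix.mulVec_injective
      funext w
      obtain ⟨Q, rfl⟩ := ef.surjective w
      rw [← hef, Matrix.neg_mulVec, Matrix.one_mulVec, ← map_neg]
      congr 1
      rw [hρ, galoisRepTorsion_apply]
      exact hneg Q
    have htr2 : (W.frobeniusTrace ℓ : ZMod 3) = -2 := by
      rw [← htr, ← htrf (ρ γ₁), hmat, Matrix.trace_neg, Matrix.trace_one, Fintype.card_fin]
      norm_num
    intro hdvd
    have h2 : ((W.frobeniusTrace ℓ - 2 : ℤ) : ZMod 3) = 0 := (ZMod.intCast_zmod_eq_zero_iff_dvd _ 3).mpr hdvd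
    rw [Int.cast_sub, htr2, Int.cast_two] at h2
    exact zmod3_neg_two_sub_two_ne h2
  -- ### (iv) the place `w = P 0` of `K` below `𝔓₀` splits completely in `R`
  obtain ⟨hP0v, h𝔔0, h𝔔0c, hτ0, hres0⟩ := hdata 0
  rw [pow_zero, one_mul, inv_one, mul_one] at hres0
  have hw0 : (P 0).asIdeal.under (𝓞 ℚ) = v.asIdeal := congrArg HeightOneSpectrum.asIdeal hP0v
  have hℓw : (ℓ : 𝓞 K) ∈ (P 0).asIdeal := by
    have h1 : (ℓ : 𝓞 ℚ) ∈ (P 0).asIdeal.under (𝓞 ℚ) := by rw [hw0]; exact hℓv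
    rw [Ideal.under_def, Ideal.mem_comap, map_natCast] at h1
    exact h1
  have hR : Algebra.IsUnramifiedIn (𝓞 R) (P 0).asIdeal → P 0 ∈ splitPrimes K R := by
    intro hunrR
    -- `τ' 0 ∈ res(Γ_R)`
    obtain ⟨δ₀, hδ₀R, hδ₀⟩ := hγ₁HR
    have hτδ : τ' 0 = δ₀ := absGaloisRestrict_injective ℚ K (hres0.trans hδ₀.symm)
    obtain ⟨τR, hτR⟩ := hδ₀R
    -- a prime of `\bar ℤ_R` above `𝔔 0` and the place of `R` below it
    obtain ⟨𝔔R, wR, h𝔔R, hwR, h𝔔RwR⟩ := exists_place_comap_eq_smul (F := K) (M := R) h𝔔0 1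
    rw [one_smul] at h𝔔R
    have hτR' : absGaloisRestrict K R τR = τ' 0 := (show absGaloisRestrict K R τR = δ₀ from hτR).trans hτδ.symm
    have hfR : wR.asIdeal.inertiaDeg (𝓞 K) = 1 := by
      refine inertiaDeg_eq_one_of_isArithFrobAt_absGaloisRestrict (F := K) (M := R) hwR h𝔔RwR (τ := τR) ?_
      rw [h𝔔R, hτR']
      exact hτ0
    haveI : wR.asIdeal.IsPrime := wR.isPrime
    have hQ : wR.asIdeal ∈ (P 0).asIdeal.primesOver (𝓞 R) := ⟨wR.isPrime, ⟨hwR.symm⟩⟩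
    exact mem_splitPrimes_of_inertiaDeg_eq_one hunrR hQ hfR
  -- ### (v) the Kummer residue condition
  -- `γ₁` fixes `e(K)` pointwise
  have hfixK : ∀ y : K, γ₁ • e y = e y := by
    obtain ⟨g, hg⟩ := hγ₁H
    intro y; rw [← hg]; exact absGaloisRestrict_smul_apply_eq g e y
  -- `γ₁ α = ω α` with `ω² + ω + 1 = 0`
  set ω₀ : AlgebraicClosure ℚ := ζ ^ (3 ^ (E - 1)) with hω₀
  have hω₀3 : ω₀ ^ 3 = 1 := by
    rw [hω₀, ← pow_mul, ← pow_succ, Nat.sub_add_cancel hE]; exact hζ.pow_eq_one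
  have hω₀1 : ω₀ ≠ 1 := by
    rw [hω₀]
    intro h
    have hd := (hζ.pow_eq_one_iff_dvd (3 ^ (E - 1))).mp h
    have hlt : 3 ^ (E - 1) < 3 ^ E := Nat.pow_lt_pow_right (by norm_num) (by omega)
    exact absurd (Nat.le_of_dvd (pow_pos (by norm_num) _) hd) (not_le.mpr hlt)
  have hω₀q : ω₀ ^ 2 + ω₀ + 1 = 0 := by
    have hfac : (ω₀ - 1) * (ω₀ ^ 2 + ω₀ + 1) = 0 := by
      have : (ω₀ - 1) * (ω₀ ^ 2 + ω₀ + 1) = ω₀ ^ 3 - 1 := by ring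
      rw [this, hω₀3, sub_self]
    exact (mul_eq_zero.mp hfac).resolve_left (sub_ne_zero.mpr hω₀1)
  have h3ne : (3 : AlgebraicClosure ℚ) ≠ 0 := by norm_num
  have hγ₁α3 : (γ₁ • α) ^ 3 = α ^ 3 := by rw [← smul_pow', hα, hfixK]
  obtain ⟨j, hj, hjα⟩ := exists_eq_pow_mul_of_pow_three_eq hω₀q hα0 hγ₁α3
  have hj0 : j ≠ 0 := by rintro rfl; rw [pow_zero, one_mul] at hjα; exact hγ₁α hjα
  set ω := ω₀ ^ j with hωdef
  have hωq : ω ^ 2 + ω + 1 = 0 := by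
    interval_cases j
    · exact absurd rfl hj0
    · rw [hωdef, pow_one]; exact hω₀q
    · rw [hωdef]
      have : (ω₀ ^ 2) ^ 2 = ω₀ ^ 3 * ω₀ := by ring
      rw [this, hω₀3, one_mul]; linear_combination hω₀q
  -- move to `\bar ℤ`
  have hxint : IsIntegral (𝓞 ℚ) (e (x : K)) := isIntegral_embedding e x
  have hαint : IsIntegral (𝓞 ℚ) α := IsIntegral.of_pow (R := 𝓞 ℚ) (by norm_num : 0 < 3) (by rw [hα]; exact hxint)
  have hωint : IsIntegral (𝓞 ℚ) ω :=
    ((hζ.isIntegral (pow_pos (by norm_num) E)).pow _ |>.pow _).tower_top (A := 𝓞 ℚ)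
  set x' : absIntegers (𝓞 ℚ) ℚ := ⟨e (x : K), hxint⟩ with hx'
  set α' : absIntegers (𝓞 ℚ) ℚ := ⟨α, hαint⟩ with hα'
  set ω' : absIntegers (𝓞 ℚ) ℚ := ⟨ω, hωint⟩ with hω'
  set y' : absIntegers (𝓞 ℚ) ℚ := ⟨e (β : K), isIntegral_embedding e β⟩ with hy'
  set z' : absIntegers (𝓞 ℚ) ℚ := ⟨e ((τ • β : 𝓞 K) : K), isIntegral_embedding e (τ • β)⟩ with hz'
  set yx' : absIntegers (𝓞 ℚ) ℚ := ⟨e (yx : K), isIntegral_embedding e yx⟩ with hyx'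
  have hα'3 : α' ^ 3 = x' := Subtype.ext (by rw [SubmonoidClass.coe_pow]; exact hα)
  have hω'q : ω' ^ 2 + ω' + 1 = 0 := Subtype.ext (by
    rw [AddMemClass.coe_add, AddMemClass.coe_add, SubmonoidClass.coe_pow, OneMemClass.coe_one, ZeroMemClass.coe_zero]; exact hωq)
  have hσα' : γ₁ • α' = ω' * α' := Subtype.ext (by rw [integralClosure.coe_smul, MulMemClass.coe_mul]; exact hjα)
  have hx'eq : x' = y' * z' ^ 2 := Subtype.ext (by
    rw [MulMemClass.coe_mul, SubmonoidClass.coe_pow]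
    change e (x : K) = e (β : K) * e ((τ • β : 𝓞 K) : K) ^ 2
    rw [← map_pow, ← map_mul]; rfl)
  -- `x' ∉ 𝔓₀` (`ℓ ∤ N(x)`)
  have hx'𝔓 : x' ∉ 𝔓₀ := by
    intro hmem
    have hyb : yx' * x' = ((n₀ : ℕ) : absIntegers (𝓞 ℚ) ℚ) := by
      apply Subtype.ext
      rw [MulMemClass.coe_mul]
      change e (yx : K) * e (x : K) = (((n₀ : ℕ) : absIntegers (𝓞 ℚ) ℚ) : AlgebraicClosure ℚ)
      have hyK : (yx : K) * (x : K) = (n₀ : K) := by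
        have h := congrArg (algebraMap (𝓞 K) K) hyx
        rw [map_mul, map_natCast] at h
        exact h
      rw [← map_mul, hyK, map_natCast]
      norm_cast
    have : ((n₀ : ℕ) : absIntegers (𝓞 ℚ) ℚ) ∈ 𝔓₀ := by rw [← hyb]; exact 𝔓₀.mul_mem_left _ hmem
    exact hnot n₀ hℓn₀' this
  -- (D4): `x^k - 1 ∉ 𝔓₀`
  have hD4 : x' ^ k - 1 ∉ 𝔓₀ :=
    pow_sub_one_not_mem_of_frob_smul_eq_mul hℓ hℓ3 hv h𝔓₀ hγ₁ hk hα'3 hx'𝔓 hω'q hσα'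
  -- (D5): `β^k - (τβ)^k ∉ 𝔓₀`
  have hz'𝔓 : z' ∉ 𝔓₀ := by
    intro hmem
    apply hx'𝔓
    rw [hx'eq, sq, ← mul_assoc]
    exact 𝔓₀.mul_mem_left _ hmem
  have hσz' : γ₁ • z' = z' := Subtype.ext (by rw [integralClosure.coe_smul]; exact hfixK _)
  have hD5 : y' ^ k - z' ^ k ∉ 𝔓₀ :=
    pow_sub_pow_not_mem_of_frob_fixed hv h𝔓₀ hγ₁ hk hσz' hz'𝔓 (by rw [← hx'eq]; exact hD4)
  refine ⟨ℓ, hℓ, hℓT, hsplit, h3E, haℓ, ⟨P 0, hℓw, hR⟩, ?_⟩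
  -- the rational residue: `β^k ≡ a (mod ℓ)` would give `β^k ≡ (τβ)^k (mod 𝔓₀)`
  rw [hkdiv]
  intro a hmem
  obtain ⟨w, hw⟩ := Ideal.mem_span_singleton'.mp hmem
  -- apply `τ`: `τ w * ℓ = (τβ)^k - a`
  have hτℓ : τ • (ℓ : 𝓞 K) = ℓ := map_natCast (MulSemiringAction.toRingHom _ (𝓞 K) τ) ℓ
  have hτa : τ • ((a : ℤ) : 𝓞 K) = a := map_intCast (MulSemiringAction.toRingHom _ (𝓞 K) τ) a
  have hwτ : (τ • w) * (ℓ : 𝓞 K) = (τ • β) ^ k - (a : 𝓞 K) := by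
    have h := congrArg (fun t : 𝓞 K ↦ τ • t) hw
    simp only [smul_mul', smul_sub, smul_pow', hτℓ, hτa] at h
    exact h
  set w₁ : 𝓞 K := w - τ • w with hw₁
  have hdiff : w₁ * (ℓ : 𝓞 K) = β ^ k - (τ • β) ^ k := by
    rw [hw₁, sub_mul, hw, hwτ]; ring
  apply hD5
  set w' : absIntegers (𝓞 ℚ) ℚ := ⟨e (w₁ : K), isIntegral_embedding e _⟩ with hw'
  have hkey : y' ^ k - z' ^ k = w' * ((ℓ : ℕ) : absIntegers (𝓞 ℚ) ℚ) := by
    apply Subtype.ext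
    rw [AddSubgroupClass.coe_sub, SubmonoidClass.coe_pow, SubmonoidClass.coe_pow, MulMemClass.coe_mul]
    change e (β : K) ^ k - e ((τ • β : 𝓞 K) : K) ^ k = e (w₁ : K) * (((ℓ : ℕ) : absIntegers (𝓞 ℚ) ℚ) : AlgebraicClosure ℚ)
    have hK' : (w₁ : K) * (ℓ : K) = (β : K) ^ k - ((τ • β : 𝓞 K) : K) ^ k := by
      clear_value w₁
      have h := congrArg (algebraMap (𝓞 K) K) hdiff
      rw [map_mul, map_natCast, map_sub, map_pow, map_pow] at h
      exact h
    have h2 : e (w₁ : K) * (ℓ : AlgebraicClosure ℚ) = e (β : K) ^ k - e ((τ • β : 𝓞 K) : K) ^ k := by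
      rw [← map_natCast e ℓ, ← map_mul, hK', map_sub, map_pow, map_pow]
    rw [← h2]
    norm_cast
  rw [hkey]
  exact 𝔓₀.mul_mem_left _ hℓ𝔓

end Summit.BirchSwinnertonDyer.BirchSwinnertonDyer.Theorems.ChebKummerThree

end
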